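import Summits.ValiantsHypothesis.ValiantsHypothesis.Theorems.KPlusLogSqLawTropicalGradedWalkDomDGlue1
import Summits.ValiantsHypothesis.ValiantsHypothesis.Theorems.KPlusLogSqLawTropicalGradedWalkLift
import Summits.ValiantsHypothesis.ValiantsHypothesis.Theorems.KPlusLogSqLawTropicalGradedWalkDomT1
import Summits.ValiantsHypothesis.ValiantsHypothesis.Theorems.KPlusLogSqLawTropicalGradedWalkDomT2
import Summits.ValiantsHypothesis.ValiantsHypothesis.Theorems.KPlusLogSqLawTropicalGradedWalkDomT3
import Summits.ValiantsHypothesis.ValiantsHypothesis.Theorems.KPlusLogSqLawTropicalGradedWalkDomT4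
import Summits.ValiantsHypothesis.ValiantsHypothesis.Theorems.KPlusLogSqLawTropicalGradedWalkDomT5
import Summits.ValiantsHypothesis.ValiantsHypothesis.Theorems.KPlusLogSqLawTropicalGradedWalkDomT6
import Summits.ValiantsHypothesis.ValiantsHypothesis.Theorems.KPlusLogSqLawTropicalGradedWalkDomT7

/-!
# Dominance glue (type T), part 1: interface lemmas; rivals at or below the intended cell

GRW-lite `K = 4` graded-walk family (census side of the tropical root law, all `m`):
dominance glue for the TOP states `(w, w, t)`, `t ≤ w < m` (`w ≥ 1`), of the design typed in
`KPlusLogSqLawTropicalGradedWalkDefs`.  The slack of every rival cell against the row potential `UT`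
(file `…PotT`) was certified family by family in `…DomT1` – `…DomT7`; the files `…DomTGlue1` – `…DomTGlue5`
dispatch an arbitrary rival `(a, b, l)` to its family (far rivals are first reduced to the best class of
their level by the generic lifts of `…GradedWalkLift`) and conclude `IsDominant` via `isDominant_of_scaledPotential`.

Honest framing: this is a census-side (lower-bound) construction — a quadratic family of
distinct optimal slopes for `TropRootLawAt (n+1) 4`.  It says nothing about `TropicalB` inside
its window and nothing about VP ≠ VNP.
-/

set_option linter.dupNamespace false
set_option autoImplicit false

namespace Summit.ValiantsHypothesis.ValiantsHypothesis.Theorems.LacunarySymmetroidMatrixDescartes.TropicalCensus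

namespace GradedWalk

open Summit.ValiantsHypothesis.ValiantsHypothesis.Theorems.MatrixDescartes.Negative

variable (n : ℕ)

/-! ### interface lemmas for the dominance glue (type T) -/

/-- the permutation of a top state is the phase rotation. -/
theorem perm_T (w t : ℕ) : perm n w w t = rot n w := by
  unfold perm; rw [if_pos (show w = w from rfl)]

/-- the class map of a top state. -/
theorem lam_T (w t : ℕ) (b : Fin (n + 1)) :
    lam n w w t b = if w ≤ (b : ℕ) then 0 else if (b : ℕ) < t then 3 else 2 := by
  unfold lam; rw [if_pos (show w = w from rfl)]

/-- the top-state slope lies below `L·E` for every future level `E > w`. -/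
theorem thT_le_LE {w t E : ℕ} (ht : t ≤ w) (hw : w ≤ n) (hE : w + 1 ≤ E) : thT n w t ≤ LL n * E := by
  have htz : (t : ℤ) ≤ w := by exact_mod_cast ht
  have hwz : (w : ℤ) ≤ n := by exact_mod_cast hw
  have hEz : (w : ℤ) + 1 ≤ E := by exact_mod_cast hE
  unfold thT LL MM
  nlinarith [mul_le_mul_of_nonneg_left hEz (show (0 : ℤ) ≤ 8 * ((n : ℤ) + 1) * ((n : ℤ) + 4) by positivity),
    mul_nonneg (show (0 : ℤ) ≤ (n : ℤ) - w by linarith) (show (0 : ℤ) ≤ (n : ℤ) + 4 by positivity)]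

/-- … in particular below `L·m`. -/
theorem thT_le_top {w t : ℕ} (ht : t ≤ w) (hw : w ≤ n) : thT n w t ≤ LL n * ((n : ℤ) + 1) := by
  have h := thT_le_LE n ht hw (le_refl (w + 1))
  have hwz : (w : ℤ) + 1 ≤ (n : ℤ) + 1 := by exact_mod_cast Nat.succ_le_succ hw
  have hL : (0 : ℤ) ≤ LL n := by unfold LL; positivity
  push_cast at h
  nlinarith [mul_le_mul_of_nonneg_left hwz hL]

/-- the top-state slope lies above `L·(E+1)` for every past level `E < w`. -/
theorem LE_le_thT {w E : ℕ} (t : ℕ) (hE : E + 1 ≤ w) : LL n * (E + 1) ≤ thT n w t := by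
  have hEz : (E : ℤ) + 1 ≤ w := by exact_mod_cast hE
  have hL : (0 : ℤ) ≤ LL n := by unfold LL; positivity
  have hM : (0 : ℤ) ≤ MM n * w := by unfold MM; positivity
  unfold thT
  nlinarith [mul_le_mul_of_nonneg_left hEz hL]

/-! ### slack, block column, rival at or below the intended cell -/

/-- slack of the type-T certificate: block column `b < w`, rival row `a ≥ r_b` (class rivals and the levels below). -/
theorem slackT_blk_ge (w t : ℕ) (htw : t ≤ w) (hwn : w ≤ n) (a b : Fin (n + 1)) (l : Fin 4)
    (hp : ee n a b l ≠ 0) (hne : rot n w b ≠ a ∨ lam n w w t b ≠ l)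
    (hbw : (b : ℕ) < w) (hge : (b : ℕ) + (n + 1 - w) ≤ (a : ℕ)) :
    1 * (thT n w t * (dd n l : ℤ) - vv n a b l) <
      UT n w t a + ((thT n w t * (dd n (lam n w w t b) : ℤ) - vv n (rot n w b) b (lam n w w t b)) - UT n w t (rot n w b)) := by
  have hw1 : w ≤ n + 1 := by omega
  have hr := rot_val_blk n hw1 b hbw
  have hlowr : (b : ℕ) < ((rot n w b : Fin (n + 1)) : ℕ) := by rw [hr]; omega
  rw [lam_T n w t, if_neg (not_le.mpr hbw)] at hne ⊢
  have hEr : n + 1 + (b : ℕ) - ((b : ℕ) + (n + 1 - w)) = w := by omega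
  have hwne : w ≠ n + 1 := by omega
  have hT2 : thT n w t * (dd n 2 : ℤ) - vv n (rot n w b) b 2 = thT n w t * d2 n - (v1 n w b + bB n * tau2lt n w b) := by
    rw [dd_cast_two, vv_lower n hlowr, hr, hEr, vblk_two, tau2_of_ne n hwne]
  have hT3 : thT n w t * (dd n 3 : ℤ) - vv n (rot n w b) b 3 = thT n w t * d3 n - ((v1 n w b + bB n * tau2lt n w b) + tau3lt n w b) := by
    rw [dd_cast_three, vv_lower n hlowr, hr, hEr, vblk_three, tau2_of_ne n hwne, tau3_of_ne n hwne]
  have hUr : UT n w t ((rot n w b : Fin (n + 1)) : ℕ) = gG n * thT n w t * ((((b : ℕ) + (n + 1 - w)) : ℕ) : ℤ) + muT n w t b := by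
    rw [hr]; unfold UT; rw [show (b : ℕ) + (n + 1 - w) - (n + 1 - w) = b by omega]
  have hUr' : UT n w t ((rot n w b : Fin (n + 1)) : ℕ) = gG n * thT n w t * (((n + 1 - w + (b : ℕ)) : ℕ) : ℤ) + muT n w t b := by
    rw [hUr, show (b : ℕ) + (n + 1 - w) = n + 1 - w + (b : ℕ) by omega]
  have hlow : (b : ℕ) < (a : ℕ) := by omega
  have hl0 : l ≠ 0 := fun h0 => hp (by rw [h0]; exact ee_lower_zero n hlow)
  rcases Nat.eq_or_lt_of_le hge with haeq | hagt
  · -- class rival at the intended cell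
    have ha' : ((rot n w b : Fin (n + 1)) : ℕ) = (a : ℕ) := by rw [hr, haeq]
    have hrot : rot n w b = a := Fin.ext ha'
    have hY : UT n w t a - UT n w t ((rot n w b : Fin (n + 1)) : ℕ) = 0 := by rw [hrot]; ring
    have hEa : n + 1 + (b : ℕ) - (a : ℕ) = w := by omega
    have hX1 : thT n w t * (dd n 1 : ℤ) - vv n a b 1 = thT n w t * d1 n - v1 n w b := by
      rw [dd_cast_one, vv_lower n hlow, hEa, vblk_one]
    have hX2 : thT n w t * (dd n 2 : ℤ) - vv n a b 2 = thT n w t * d2 n - (v1 n w b + bB n * tau2lt n w b) := by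
      rw [dd_cast_two, vv_lower n hlow, hEa, vblk_two, tau2_of_ne n hwne]
    have hX3 : thT n w t * (dd n 3 : ℤ) - vv n a b 3 = thT n w t * d3 n - ((v1 n w b + bB n * tau2lt n w b) + tau3lt n w b) := by
      rw [dd_cast_three, vv_lower n hlow, hEa, vblk_three, tau2_of_ne n hwne, tau3_of_ne n hwne]
    by_cases ht0 : t = 0
    · subst ht0
      rw [if_neg (Nat.not_lt_zero _)] at hne ⊢
      rcases (show l = 0 ∨ l = 1 ∨ l = 2 ∨ l = 3 by fin_cases l <;> simp) with rfl | rfl | rfl | rfl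
      · exact absurd rfl hl0
      · exact slack_of0 (T_cls_z_l1 n w b (by omega) (by omega)) hX1 hT2 hY
      · exact absurd rfl (hne.resolve_left (fun h => h hrot))
      · exact slack_of0 (T_cls_z_l3 n w b (by omega) (by omega)) hX3 hT2 hY
    · by_cases hbt : (b : ℕ) < t
      · rw [if_pos hbt] at hne ⊢
        rcases (show l = 0 ∨ l = 1 ∨ l = 2 ∨ l = 3 by fin_cases l <;> simp) with rfl | rfl | rfl | rfl
        · exact absurd rfl hl0
        · exact slack_of0 (T_cls_l_l1 n w t b (by omega) (by omega) (by omega)) hX1 hT3 hY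
        · exact slack_of0 (T_cls_l_l2 n w t b (by omega) (by omega) (by omega)) hX2 hT3 hY
        · exact absurd rfl (hne.resolve_left (fun h => h hrot))
      · rw [if_neg hbt] at hne ⊢
        rcases (show l = 0 ∨ l = 1 ∨ l = 2 ∨ l = 3 by fin_cases l <;> simp) with rfl | rfl | rfl | rfl
        · exact absurd rfl hl0
        · exact slack_of0 (T_cls_g_l1 n w t b (by omega) (by omega) (by omega) (by omega)) hX1 hT2 hY
        · exact absurd rfl (hne.resolve_left (fun h => h hrot))
        · exact slack_of0 (T_cls_g_l3 n w t b (by omega) (by omega) (by omega) (by omega)) hX3 hT2 hY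
  · -- rival below the intended cell: level w - k
    obtain ⟨k, hk⟩ : ∃ k, (a : ℕ) = (b : ℕ) + (n + 1 - w) + k := ⟨(a : ℕ) - ((b : ℕ) + (n + 1 - w)), by omega⟩
    have hk1 : 1 ≤ k := by omega
    have hkw : (b : ℕ) + k + 1 ≤ w := by omega
    have hEa : n + 1 + (b : ℕ) - (a : ℕ) = w - k := by omega
    have hne3 : w - k ≠ n + 1 := by omega
    have hθ : LL n * ((w - k : ℕ) + 1) ≤ thT n w t := LE_le_thT n t (by omega)
    have hbn : (b : ℕ) ≤ n := by omega
    -- reduce every class to class 3 (the best past class)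
    have hX3 : thT n w t * (dd n 3 : ℤ) - vv n a b 3 = thT n w t * d3 n - ((v1 n (w - k) b + bB n * tau2lt n (w - k) b) + tau3lt n (w - k) b) := by
      rw [dd_cast_three, vv_lower n hlow, hEa, vblk_three, tau2_of_ne n hne3, tau3_of_ne n hne3]
    have hlift : thT n w t * (dd n l : ℤ) - vv n a b l + (if l = 3 then 0 else 1) ≤ thT n w t * d3 n - ((v1 n (w - k) b + bB n * tau2lt n (w - k) b) + tau3lt n (w - k) b) := by
      rcases (show l = 0 ∨ l = 1 ∨ l = 2 ∨ l = 3 by fin_cases l <;> simp) with rfl | rfl | rfl | rfl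
      · exact absurd rfl hl0
      · rw [dd_cast_one, vv_lower n hlow, hEa, vblk_one]
        simp only [show ((1 : Fin 4) = 3) = False by decide, ite_false]
        have h := lift_past1 n (θ := thT n w t) (c := (b : ℕ)) hbn (by omega) hθ
        linarith
      · rw [dd_cast_two, vv_lower n hlow, hEa, vblk_two, tau2_of_ne n hne3]
        simp only [show ((2 : Fin 4) = 3) = False by decide, ite_false]
        have h := lift_past2 n (θ := thT n w t) (c := (b : ℕ)) hbn (by omega) hθ
        linarith
      · rw [hX3]; simp
    have hj : (a : ℕ) - (n + 1 - w) = (b : ℕ) + k := by omega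
    by_cases ht0 : t = 0
    · subst ht0
      rw [if_neg (Nat.not_lt_zero _)] at hne ⊢
      have hY : UT n w 0 a - UT n w 0 ((rot n w b : Fin (n + 1)) : ℕ) = gG n * thT n w 0 * ((k : ℕ) : ℤ) + (ST0 n w (b + k) - ST0 n w b) := by
        rw [hUr, muT_z]; unfold UT; rw [hj, muT_z, hk]; push_cast [Nat.cast_sub hw1]; ring
      have hF := T_down_Z n w b k (by omega) (by omega) (by omega)
      exact slack_of (by split_ifs at hlift <;> linarith) rfl hT2 hY
    · by_cases hbt : (b : ℕ) < t
      · rw [if_pos hbt] at hne ⊢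
        rcases Nat.lt_or_ge ((b : ℕ) + k) t with hlt | hge'
        · have hY : UT n w t a - UT n w t ((rot n w b : Fin (n + 1)) : ℕ) = gG n * thT n w t * ((k : ℕ) : ℤ) + (SUB3 n w t (b + k) - SUB3 n w t b) := by
            rw [hUr, muT_lt n hbt]; unfold UT; rw [hj, muT_lt n hlt, hk]; push_cast [Nat.cast_sub hw1]; ring
          have hF := T_down_A n w t b k (by omega) (by omega) (by omega) (by omega)
          exact slack_of (by split_ifs at hlift <;> linarith) rfl hT3 hY
        · have hY : UT n w t a - UT n w t ((rot n w b : Fin (n + 1)) : ℕ) = gG n * thT n w t * ((k : ℕ) : ℤ) + (STB n w t (b + k) - SUB3 n w t b) := by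
            rw [hUr, muT_lt n hbt]; unfold UT; rw [hj, muT_ge n ht0 (by omega), hk]; push_cast [Nat.cast_sub hw1]; ring
          have hF := T_down_C n w t b k (by omega) (by omega) (by omega) (by omega)
          exact slack_of (by split_ifs at hlift <;> linarith) rfl hT3 hY
      · rw [if_neg hbt] at hne ⊢
        have hY : UT n w t a - UT n w t ((rot n w b : Fin (n + 1)) : ℕ) = gG n * thT n w t * ((k : ℕ) : ℤ) + (STB n w t (b + k) - STB n w t b) := by
          rw [hUr, muT_ge n ht0 hbt]; unfold UT; rw [hj, muT_ge n ht0 (by omega), hk]; push_cast [Nat.cast_sub hw1]; ring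
        have hF := T_down_E n w t b k (by omega) (by omega) (by omega) (by omega) (by omega)
        exact slack_of (by split_ifs at hlift <;> linarith) rfl hT2 hY

end GradedWalk

end Summit.ValiantsHypothesis.ValiantsHypothesis.Theorems.LacunarySymmetroidMatrixDescartes.TropicalCensus
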